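import Literature.NumberTheory.GaloisRepresentations.PAdicHodge
import Literature.NumberTheory.GaloisRepresentations.RestrictFieldSelf
import HarnessLib

/-!
# `B`-admissibility is insensitive to an inner automorphism of `Γ`; the self-restriction
# `absGaloisRestrict K K` is inner

Topic `Literature/NumberTheory/GaloisRepresentations`; namespace
`Literature.NumberTheory.GaloisRepresentations` (sub-namespace `PeriodRingData` for the abstract part). THEOREMS ONLY
(no definition, no named fact, no instance, no `sorry`).

For a period-ring datum `𝔅 = (B, Γ ↷, E ⊆ B, Fil^•)` (Fontaine's regular `(P, Γ)`-rings, tree `PeriodRingData`) and a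
continuous representation `ρ : Γ → GL(V)`, the restriction `ρ ∘ r` along an INNER automorphism `r(σ) = τ⁻¹ σ τ` of
`Γ` has the same `D_B`: the `E`-linear automorphism `τ⁻¹ ⊗ 1` of `B ⊗ V` carries `D_B(ρ ∘ r)` onto `D_B(ρ)`
(`map_D_restrict_eq_of_conj`), so `dim_E D_B(ρ ∘ r) = dim_E D_B(ρ)` and **`ρ ∘ r` is `B`-admissible iff `ρ` is**
(`isAdmissible_restrict_iff_of_conj`) — Fontaine, Astérisque 223, Exp. III §1.3–1.5 (the functor `D_B` on
`B`-representations; an inner twist is an isomorphic `B`-representation).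

The tree's restriction map `absGaloisRestrict K L : Γ_L → Γ_K` along the CHOSEN embedding `K̄ → L̄` is, at `L = K`, an
inner automorphism of `Γ_K` (tree `exists_absGaloisRestrict_self_eq_conj`, file `RestrictFieldSelf`). Consequently (`GaloisRep.isDeRham_restrict_absGaloisRestrict_self_iff`) a Galois representation `ρ` of `F` is de Rham
(for any period-ring datum over `Γ_F`) iff its self-restriction `ρ.restrict (absGaloisRestrict F F)` is — the bridge
between the two shapes `restrictedRationalTateRep W F p` (curve over a subfield `K₀ = F`) and `rationalTateRep W p`
in which the tree states the de Rham input of the elliptic `p`-adic Hodge facts (`DualExpElliptic`, `NeronDeRhamDatum`).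

## References
* J.-M. Fontaine, *Représentations p-adiques semi-stables*, Astérisque 223 (1994), Exp. III §1.3–§1.5.
  [FontaineAsterisque223III]
* J. S. Milne, *Fields and Galois Theory* (2022), §7 (restriction maps defined up to conjugation). [MilneFT2022]
-/

noncomputable section

open scoped TensorProduct
open TensorProduct

namespace Literature.NumberTheory.GaloisRepresentations

universe u v v' w w'

namespace PeriodRingData

-- Mathlib's own global value; needed for instance problems on `𝔅.B ⊗[P] M` (see `PAdicHodgeProofs`).
set_option maxSynthPendingDepth 3

variable {Γ : Type u} [Group Γ] [TopologicalSpace Γ] {P : Type v} {E : Type v'} [Field P]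
  [TopologicalSpace P] [Field E] [Algebra P E]
  {M : Type w'} [AddCommGroup M] [Module P M] [TopologicalSpace M]
  (𝔅 : PeriodRingData.{u, v, v', w} Γ P E) (ρ : ContinuousRep Γ P M)

/-- **Intertwining**: for `r(σ) = τ⁻¹ σ τ`, the automorphism `Φ = τ⁻¹ ⊗ 1` of `B ⊗ V` satisfies
`Φ ∘ (ρ ∘ r)_{B}(τ σ τ⁻¹) = ρ_B(σ) ∘ Φ` for the diagonal actions.
[cite: FontaineAsterisque223III, Exp. III §1.3] -/
theorem congr_tensorRep_restrict_of_conj (τ : Γ) (r : Γ →ₜ* Γ) (hr : ∀ σ, r σ = τ⁻¹ * σ * τ) (σ : Γ)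
    (x : 𝔅.B ⊗[P] M) :
    AlgebraTensorModule.congr (DistribMulAction.toLinearEquiv E 𝔅.B τ⁻¹) (LinearEquiv.refl P M)
        (𝔅.tensorRep (ρ.restrict r) (τ * σ * τ⁻¹) x) =
      𝔅.tensorRep ρ σ
        (AlgebraTensorModule.congr (DistribMulAction.toLinearEquiv E 𝔅.B τ⁻¹) (LinearEquiv.refl P M) x) := by
  induction x using TensorProduct.induction_on with
  | zero => simp only [map_zero]
  | tmul b m =>
    rw [tensorRep_apply_tmul, AlgebraTensorModule.congr_tmul, AlgebraTensorModule.congr_tmul,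
      tensorRep_apply_tmul, ContinuousRep.restrict_apply, hr]
    simp only [DistribMulAction.toLinearEquiv_apply, LinearEquiv.refl_apply, smul_smul]
    congr 2
    · group
    · congr 2; group
  | add x y hx hy => rw [map_add, map_add, hx, hy, map_add, map_add]

/-- The inverse intertwining: `Φ⁻¹ ∘ ρ_B(σ) = (ρ ∘ r)_B(τ σ τ⁻¹) ∘ Φ⁻¹`, `Φ⁻¹ = τ ⊗ 1`.
[cite: FontaineAsterisque223III, Exp. III §1.3] -/
theorem congr_symm_tensorRep_of_conj (τ : Γ) (r : Γ →ₜ* Γ) (hr : ∀ σ, r σ = τ⁻¹ * σ * τ) (σ : Γ)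
    (y : 𝔅.B ⊗[P] M) :
    (AlgebraTensorModule.congr (DistribMulAction.toLinearEquiv E 𝔅.B τ⁻¹) (LinearEquiv.refl P M)).symm
        (𝔅.tensorRep ρ σ y) =
      𝔅.tensorRep (ρ.restrict r) (τ * σ * τ⁻¹)
        ((AlgebraTensorModule.congr (DistribMulAction.toLinearEquiv E 𝔅.B τ⁻¹) (LinearEquiv.refl P M)).symm y) := by
  set Φ := AlgebraTensorModule.congr (DistribMulAction.toLinearEquiv E 𝔅.B τ⁻¹) (LinearEquiv.refl P M) with hΦ
  apply Φ.injective
  rw [LinearEquiv.apply_symm_apply, congr_tensorRep_restrict_of_conj 𝔅 ρ τ r hr σ, LinearEquiv.apply_symm_apply]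

/-- **`(τ⁻¹ ⊗ 1) D_B(ρ ∘ r) = D_B(ρ)` for the inner automorphism `r(σ) = τ⁻¹ σ τ`.**
[cite: FontaineAsterisque223III, Exp. III §1.3 and §1.5] -/
theorem map_D_restrict_eq_of_conj (τ : Γ) (r : Γ →ₜ* Γ) (hr : ∀ σ, r σ = τ⁻¹ * σ * τ) :
    (𝔅.D (ρ.restrict r)).map
        (AlgebraTensorModule.congr (DistribMulAction.toLinearEquiv E 𝔅.B τ⁻¹) (LinearEquiv.refl P M) :
          𝔅.B ⊗[P] M ≃ₗ[E] 𝔅.B ⊗[P] M).toLinearMap = 𝔅.D ρ := by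
  set Φ := AlgebraTensorModule.congr (DistribMulAction.toLinearEquiv E 𝔅.B τ⁻¹) (LinearEquiv.refl P M) with hΦ
  apply le_antisymm
  · rintro _ ⟨x, hx, rfl⟩
    rw [SetLike.mem_coe, mem_D_iff] at hx
    rw [mem_D_iff]
    intro σ
    have h := congr_tensorRep_restrict_of_conj 𝔅 ρ τ r hr σ x
    rw [hx (τ * σ * τ⁻¹)] at h
    exact h.symm
  · intro y hy
    rw [mem_D_iff] at hy
    refine ⟨Φ.symm y, ?_, Φ.apply_symm_apply y⟩
    rw [SetLike.mem_coe, mem_D_iff]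
    intro g
    have h := congr_symm_tensorRep_of_conj 𝔅 ρ τ r hr (τ⁻¹ * g * τ) y
    rw [hy] at h
    have hg : τ * (τ⁻¹ * g * τ) * τ⁻¹ = g := by group
    rw [hg] at h
    exact h.symm

/-- **`dim_E D_B(ρ ∘ r) = dim_E D_B(ρ)` for an inner automorphism `r` of `Γ`.**
[cite: FontaineAsterisque223III, Exp. III §1.5] -/
theorem finrank_D_restrict_eq_of_conj (τ : Γ) (r : Γ →ₜ* Γ) (hr : ∀ σ, r σ = τ⁻¹ * σ * τ) :
    Module.finrank E (𝔅.D (ρ.restrict r)) = Module.finrank E (𝔅.D ρ) :=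
  (LinearEquiv.ofSubmodules _ _ _ (𝔅.map_D_restrict_eq_of_conj ρ τ r hr)).finrank_eq

/-- **`B`-admissibility is invariant under inner automorphisms of `Γ`**: `ρ ∘ r` is `B`-admissible iff `ρ` is,
for `r(σ) = τ⁻¹ σ τ` (an inner twist is an isomorphic `B`-representation).
[cite: FontaineAsterisque223III, Exp. III §1.5] -/
theorem isAdmissible_restrict_iff_of_conj (τ : Γ) (r : Γ →ₜ* Γ) (hr : ∀ σ, r σ = τ⁻¹ * σ * τ) :
    𝔅.IsAdmissible (ρ.restrict r) ↔ 𝔅.IsAdmissible ρ := by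
  rw [IsAdmissible, IsAdmissible, 𝔅.finrank_D_restrict_eq_of_conj ρ τ r hr]

end PeriodRingData

/-! ### Galois representations: de Rham-ness of the self-restriction -/

namespace GaloisRep

variable {P : Type v} {F : Type} [Field P] [TopologicalSpace P] [Field F] [Algebra P F]
  {M : Type w'} [AddCommGroup M] [Module P M] [TopologicalSpace M]

/-- **A Galois representation of `F` is de Rham iff its self-restriction along `absGaloisRestrict F F` is** (for
any period-ring datum over `Γ_F`): the self-restriction is an inner twist (tree
`exists_absGaloisRestrict_self_eq_conj`, file `RestrictFieldSelf`), and admissibility is invariant under inner twists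
(`PeriodRingData.isAdmissible_restrict_iff_of_conj`). [cite: FontaineAsterisque223III, Exp. III §1.5] -/
theorem isDeRham_restrict_absGaloisRestrict_self_iff
    (𝔅 : PeriodRingData.{0, v, 0, w} (Field.absoluteGaloisGroup F) P F) (ρ : GaloisRep F P M) :
    IsDeRham 𝔅 (ρ.restrict (absGaloisRestrict F F)) ↔ IsDeRham 𝔅 ρ := by
  obtain ⟨σ₀, hσ₀⟩ := exists_absGaloisRestrict_self_eq_conj (K := F)
  exact 𝔅.isAdmissible_restrict_iff_of_conj ρ σ₀ (absGaloisRestrict F F) fun σ => by rw [hσ₀ σ, inv_inv]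

end GaloisRep

end Literature.NumberTheory.GaloisRepresentations

end
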